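/-
Copyright (c) 2026 the pub-hodgecm-mathlib formalisation cell (harness21).  Literature-prover seat hodgecm-mathlib-B-typ04 (g35) («B-ROTA-1» (iii),
off-rota Literature discharger): the LOCAL INPUT «distinct quadratic extensions of a `p`-adic field have distinct norm groups», 2026-09-04.
-/
import Literature.NumberTheory.LocalFields.LocalFieldInvolutionNormIndexTwo      -- ★ `LocalFieldInvolutionNorm.exists_fixed_nonnorm_dichotomy` (B-typ04 (g34)): `[F^× : N E^×] = 2` exactly
import Literature.NumberTheory.GaloisRepresentations.LocalFieldFiniteExtension    -- ★ `FiniteExtension.exists_isNonarchimedeanLocalField` (Serre II §2 Prop. 3)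
import Mathlib.Algebra.QuadraticAlgebra.Basic
import HarnessLib

/-!
# Distinct quadratic extensions of a `p`-adic field have distinct norm groups: for `a, b, ab ∉ K^{×2}` the binary norm forms
# `x² − a y²` and `x² − b y²` together represent EVERY element of `K^×` (Neukirch, *Algebraic Number Theory* V (3.2): the quadratic
# Hilbert symbol is symmetric and non-degenerate)

Topic `NumberTheory/LocalFields`; namespace `Literature.NumberTheory.LocalFields.QuadraticNormGroups`.  THEOREMS ONLY (kernel-checked; no
definition, no named fact, no `sorry`, no instance, no notation); count-neutral local algebra.  Cell `pub/hodgecm-mathlib`, seat B-typ04 (g35), in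
support of the `p`-ADIC rows of the Rogawski carpet ★ `Rogawski1990.Ch3Sec10to13` whose printed proofs use local class field theory for a SECOND
quadratic extension of the ground field (★ `prop3121cPadic`, ★ `prop3121aLocal`: the elliptic Cartan subgroups `T_K` of `U(2)` of type (2),
«`H¹(F, T) = K^*/N_{KE/K}((KE)^*)`», [Rogawski1990, §3.12 p. 37]) — the one input beyond ★ `LocalFieldInvolutionNormIndexTwo` is proved here.

THE STATEMENTS.  `K` a field; for `d ∈ K` write `N_d = {x² − d y² : x, y ∈ K} ∖ {0}` (the norms from `K(√d)` when `d ∉ K²`; spelled out, no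
definition is introduced).  §1 (any field): `N_d` is closed under products and inverses (Brahmagupta), and the SYMMETRY of the Hilbert symbol
«`(a,b) = (b,a)`»: for non-squares `d, q`, `q ∈ N_d ⟺ d ∈ N_q` (**`binNorm_symm`**).  §2 (`K` a non-archimedean local field of characteristic `0`,
Mathlib `IsNonarchimedeanLocalField K`, `CharZero K`; `d ∉ K²`): **`binNorm_dichotomy`** — there is a `t ∈ K^× ∖ N_d` with `K^× = N_d ⊔ t⁻¹N_d`
(`[K^× : N_d] = 2` exactly; ★ `LocalFieldInvolutionNorm.exists_fixed_nonnorm_dichotomy` applied to the field `K(√d)` = Mathlib `QuadraticAlgebra K d 0`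
with its conjugation `star`, made a local field by ★ `FiniteExtension.exists_isNonarchimedeanLocalField`), whence **`binNorm_mul_of_not_binNorm`** (two
non-norms multiply to a norm).  §3 THE THEOREM, for `a, b ∈ K` with `a, b, ab ∉ K²` (i.e. `K(√a) ≠ K(√b)` two quadratic field extensions):
**`exists_binNorm_not_binNorm`** — some element of `N_b` is not in `N_a` («distinct quadratic extensions have distinct norm groups», equivalently the
non-degeneracy of the quadratic Hilbert symbol, Neukirch V (3.2) (vi)); **`exists_eq_binNorm_mul_binNorm`** — every `c ∈ K^×` is a product
`(p² − a q²)(r² − b s²)` (`N_a · N_b = K^×`); and the reading used by the Rogawski carpet, **`exists_eq_binNorm_mul_binNorm'`** — every `c ∈ K^×` is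
`(p² − a q²)(r² − ab s²)` (the norm group `N_{L/L₀}` of the biquadratic `L = K(√a, √b)` over `L₀ = K(√b)` contains `N_a · N_{ab} = K^×`).

THE PROOF of §3 (elementary from §1–§2; NO class field theory, no Hilbert-symbol formula, dyadic `K` included).  If `N_b ⊄ N_a` pick
`e ∈ N_b ∖ N_a`; for `c ∉ N_a`, `c·e⁻¹ ∈ N_a` (two non-norms), so `c = (c e⁻¹)·e ∈ N_a N_b`.  If `N_b ⊆ N_a` then `N_a = N_b` (both of index
two: a `q ∈ N_a ∖ N_b` would give `t_b q, t_b t_a ∈ N_b ⊆ N_a`, so `t_b, t_a ∈ N_a`), and then EVERY `q ∈ K^×` lies in `N_{ab}`: squares do; for a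
non-square `q`, symmetry turns `q ∈ N_a ⟺ a ∈ N_q` and `q ∈ N_b ⟺ b ∈ N_q`, so `a, b` are both in or both outside `N_q`, hence `ab ∈ N_q`, hence
`q ∈ N_{ab}` — contradicting `[K^× : N_{ab}] = 2`.  (This is Neukirch's (3.2): (iii) «`(a,b) = 1 ⟺ a` is a norm from `K(√b)`», (iv) symmetry,
(i) bilinearity ⟸ index two, (vi) non-degeneracy; for `n = 2` the non-degeneracy is exactly «`N_{K(√a)} = N_{K(√b)} ⟹ ab ∈ K^{×2}`».)

HONEST LABEL: HC_CM is proved only modulo the 7 printed citations (2 remaining named inputs: hLiu418 = stmt-HodgeConjecture-24832, h413 =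
stmt-HodgeConjecture-24833) until rung 0 closes; this file is off that cone, count-neutral (0 definitions, 0 named facts, 0 sorry).

## References
* [Neukirch1999] J. Neukirch, *Algebraic Number Theory*, Grundlehren 322 (Springer 1999), Ch. V §3 «The Hilbert Symbol», Prop. (3.2) (i), (iii),
  (iv), (vi), pp. 333–334 (held text `book:bynd-algebraic-number-theory`, chunks p0301–p0302); Ch. V (1.3) (`(K^* : N L^*) = 2`).
* [Serre1979] J.-P. Serre, *Local Fields*, GTM 67 (1979), Ch. V §3 Cor. 3 to Prop. 5, Ch. XIV §2–§3 (local norm index; Hilbert symbol).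
* [Rogawski1990] J. D. Rogawski, *Automorphic Representations of Unitary Groups in Three Variables*, Ann. of Math. Stud. 123 (1990), §3.12
  Prop. 3.12.1 (d) p. 37 (chunk p0041): «If `T` is of type (2), then the image of `H¹(Z, F)` in `H¹(F, T)` is trivial», `H¹(F,T) = K^*/N_{KE/K}((KE)^*)`.
-/

set_option autoImplicit false

noncomputable section

namespace Literature.NumberTheory.LocalFields.QuadraticNormGroups

/-! ## §1 Binary norm forms `x² − d y²` over a field: products, inverses, symmetry -/

section Field

variable {K : Type*} [Field K]

/-- **Brahmagupta**: `(x² − d y²)(u² − d v²) = (xu + dyv)² − d(xv + yu)²` — the values of `x² − d y²` are closed under multiplication.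
[cite: Neukirch1999, Ch. V §3 Prop. (3.2) (i) p. 334 (chunk p0302)] -/
theorem binNorm_mul {d q q' : K} (hq : ∃ x y : K, x ^ 2 - d * y ^ 2 = q) (hq' : ∃ x y : K, x ^ 2 - d * y ^ 2 = q') :
    ∃ x y : K, x ^ 2 - d * y ^ 2 = q * q' := by
  obtain ⟨x, y, rfl⟩ := hq
  obtain ⟨u, v, rfl⟩ := hq'
  exact ⟨x * u + d * y * v, x * v + y * u, by ring⟩

/-- Squares are values of `x² − d y²` (`y = 0`): `(e², d) = 1`. [cite: Neukirch1999, Ch. V §3 Prop. (3.2) (i), (iii) p. 334 (chunk p0302)] -/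
theorem binNorm_sq (d e : K) : ∃ x y : K, x ^ 2 - d * y ^ 2 = e ^ 2 :=
  ⟨e, 0, by ring⟩

/-- `1` is a value of `x² − d y²`: `(1, d) = 1`. [cite: Neukirch1999, Ch. V §3 Prop. (3.2) (i) p. 334 (chunk p0302)] -/
theorem binNorm_one (d : K) : ∃ x y : K, x ^ 2 - d * y ^ 2 = 1 :=
  ⟨1, 0, by ring⟩

/-- `−d` is a value of `x² − d y²` (`x = 0, y = 1`): «`(a, −a) = 1`». [cite: Neukirch1999, Ch. V §3 Prop. (3.2) (v) p. 334 (chunk p0302)] -/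
theorem binNorm_neg_self (d : K) : ∃ x y : K, x ^ 2 - d * y ^ 2 = -d :=
  ⟨0, 1, by ring⟩

/-- Inverses: `q⁻¹ = (x/q)² − d (y/q)²` for `q = x² − d y² ≠ 0`. [cite: Neukirch1999, Ch. V §3 Prop. (3.2) (i) p. 334 (chunk p0302)] -/
theorem binNorm_inv {d q : K} (hq0 : q ≠ 0) (hq : ∃ x y : K, x ^ 2 - d * y ^ 2 = q) :
    ∃ x y : K, x ^ 2 - d * y ^ 2 = q⁻¹ := by
  obtain ⟨x, y, hxy⟩ := hq
  refine ⟨x / q, y / q, ?_⟩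
  rw [← hxy] at hq0 ⊢
  field_simp

/-- Quotients: `q/q' ∈ N_d` for `q, q' ∈ N_d`, `q' ≠ 0` (`N_d` is a subgroup of `K^×`). [cite: Neukirch1999, Ch. V §3 Prop. (3.2) (i) p. 334 (chunk p0302)] -/
theorem binNorm_div {d q q' : K} (hq'0 : q' ≠ 0) (hq : ∃ x y : K, x ^ 2 - d * y ^ 2 = q) (hq' : ∃ x y : K, x ^ 2 - d * y ^ 2 = q') :
    ∃ x y : K, x ^ 2 - d * y ^ 2 = q / q' := by
  rw [div_eq_mul_inv]
  exact binNorm_mul hq (binNorm_inv hq'0 hq')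

/-- Cancelling a norm: if `q' ∈ N_d`, `q' ≠ 0` and `q'·q ∈ N_d` then `q ∈ N_d` (`N_d` is a subgroup of `K^×`). [cite: Neukirch1999, Ch. V §3 Prop. (3.2) (i) p. 334 (chunk p0302)] -/
theorem binNorm_of_binNorm_mul {d q q' : K} (hq'0 : q' ≠ 0) (hq' : ∃ x y : K, x ^ 2 - d * y ^ 2 = q')
    (hqq' : ∃ x y : K, x ^ 2 - d * y ^ 2 = q' * q) : ∃ x y : K, x ^ 2 - d * y ^ 2 = q := by
  have h := binNorm_div hq'0 hqq' hq'
  rwa [mul_div_cancel_left₀ _ hq'0] at h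

/-- A non-norm times a norm is a non-norm (`N_d` is a subgroup of `K^×`). [cite: Neukirch1999, Ch. V §3 Prop. (3.2) (i) p. 334 (chunk p0302)] -/
theorem not_binNorm_mul {d q q' : K} (hq'0 : q' ≠ 0)
    (hq : ∀ x y : K, x ^ 2 - d * y ^ 2 ≠ q) (hq' : ∃ x y : K, x ^ 2 - d * y ^ 2 = q') :
    ∀ x y : K, x ^ 2 - d * y ^ 2 ≠ q' * q := by
  intro x y h
  obtain ⟨x', y', h'⟩ := binNorm_of_binNorm_mul hq'0 hq' ⟨x, y, h⟩
  exact hq x' y' h'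

/-- Scaling `d` by a square does not change the value set: `x² − (d e²) y² = x² − d (e y)²` (the symbol lives on `K^×/K^{×2}`). [cite: Neukirch1999, Ch. V §3 p. 333 (chunk p0301)] -/
theorem binNorm_mul_sq_iff {d q : K} {e : K} (he : e ≠ 0) :
    (∃ x y : K, x ^ 2 - d * e ^ 2 * y ^ 2 = q) ↔ ∃ x y : K, x ^ 2 - d * y ^ 2 = q := by
  constructor
  · rintro ⟨x, y, h⟩
    exact ⟨x, e * y, by linear_combination h⟩
  · rintro ⟨x, y, h⟩
    exact ⟨x, y / e, by field_simp; linear_combination h⟩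

/-- **SYMMETRY of the quadratic Hilbert symbol** «`(a,b) = (b,a)`»: if `q = x² − d y²` with `q` NOT a square then `y ≠ 0` and
`d = (x/y)² − q (1/y)²`, so `d ∈ N_q`. [cite: Neukirch1999, Ch. V §3 Prop. (3.2) (iii), (iv) p. 334 (chunk p0302)] -/
theorem binNorm_symm {d q : K} (hq : ∀ e : K, e ^ 2 ≠ q) (h : ∃ x y : K, x ^ 2 - d * y ^ 2 = q) :
    ∃ x y : K, x ^ 2 - q * y ^ 2 = d := by
  obtain ⟨x, y, hxy⟩ := h
  have hy : y ≠ 0 := by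
    rintro rfl
    apply hq x
    linear_combination hxy
  refine ⟨x / y, 1 / y, ?_⟩
  field_simp
  linear_combination hxy

/-- Symmetry as an equivalence, for two non-squares `d, q`. [cite: Neukirch1999, Ch. V §3 Prop. (3.2) (iv) p. 334 (chunk p0302)] -/
theorem binNorm_symm_iff {d q : K} (hd : ∀ e : K, e ^ 2 ≠ d) (hq : ∀ e : K, e ^ 2 ≠ q) :
    (∃ x y : K, x ^ 2 - d * y ^ 2 = q) ↔ ∃ x y : K, x ^ 2 - q * y ^ 2 = d :=
  ⟨binNorm_symm hq, binNorm_symm hd⟩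

end Field

/-! ## §2 Over a `p`-adic field: `[K^× : N_d] = 2` exactly (through `K(√d) = QuadraticAlgebra K d 0`) -/

section LocalField

open ValuativeRel

variable {K : Type} [Field K] [ValuativeRel K] [TopologicalSpace K] [IsNonarchimedeanLocalField K]

/-- **`[K^× : N_d] = 2` EXACTLY** for a non-square `d` of a `p`-adic field `K` (`char K = 0`): there is a `t ≠ 0` which is not of the form
`x² − d y²`, and every `q ≠ 0` is `x² − d y²` or satisfies `t·q = x² − d y²`.  (★ `LocalFieldInvolutionNorm.exists_fixed_nonnorm_dichotomy` for the
conjugation of the local field `K(√d)` = Mathlib `QuadraticAlgebra K d 0`, whose norm form is `x² − d y²`.)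
[cite: Neukirch1999, Ch. V (1.3); Ch. V §3 Prop. (3.2) (iii) p. 334 (chunk p0302)] [cite: Serre1979, Ch. V §3 Cor. 3 to Prop. 5; Ch. XIV §2] -/
theorem binNorm_dichotomy [CharZero K] {d : K} (hd : ∀ e : K, e ^ 2 ≠ d) :
    ∃ t : K, t ≠ 0 ∧ (∀ x y : K, x ^ 2 - d * y ^ 2 ≠ t) ∧
      ∀ q : K, q ≠ 0 → (∃ x y : K, x ^ 2 - d * y ^ 2 = q) ∨ ∃ x y : K, x ^ 2 - d * y ^ 2 = t * q := by
  haveI : Fact (∀ r : K, r ^ 2 ≠ d + 0 * r) := ⟨fun r => by rw [zero_mul, add_zero]; exact hd r⟩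
  obtain ⟨v, τ, hL, -⟩ :=
    Literature.NumberTheory.GaloisRepresentations.FiniteExtension.exists_isNonarchimedeanLocalField K (QuadraticAlgebra K d 0)
  letI := v
  letI := τ
  haveI := hL
  have hnorm : ∀ z : QuadraticAlgebra K d 0,
      z * starRingEnd (QuadraticAlgebra K d 0) z = algebraMap K (QuadraticAlgebra K d 0) (z.re ^ 2 - d * z.im ^ 2) := by
    intro z
    rw [starRingEnd_apply, ← QuadraticAlgebra.algebraMap_norm_eq_mul_star, QuadraticAlgebra.norm_def]
    congr 1
    ring
  have hσσ : ∀ z : QuadraticAlgebra K d 0, starRingEnd _ (starRingEnd _ z) = z := fun z => by simp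
  have hσ1 : starRingEnd (QuadraticAlgebra K d 0) ≠ RingHom.id _ := by
    intro h
    have h1 := congrArg (fun f : QuadraticAlgebra K d 0 →+* QuadraticAlgebra K d 0 => (f ⟨0, 1⟩).im) h
    simp only [starRingEnd_apply, QuadraticAlgebra.im_star, RingHom.id_apply] at h1
    norm_num at h1
  obtain ⟨c, hσc, hc0, hcn, hdich⟩ :=
    Literature.NumberTheory.LocalFields.LocalFieldInvolutionNorm.exists_fixed_nonnorm_dichotomy (starRingEnd (QuadraticAlgebra K d 0)) hσσ hσ1
  -- a `star`-fixed element has `im = 0`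
  have him : ∀ z : QuadraticAlgebra K d 0, starRingEnd _ z = z → z = algebraMap K _ z.re := by
    intro z hz
    have h1 := congrArg QuadraticAlgebra.im hz
    simp only [starRingEnd_apply, QuadraticAlgebra.im_star] at h1
    have h2 : z.im = 0 := by linear_combination -(h1 / 2)
    ext
    · rw [QuadraticAlgebra.algebraMap_re]
    · rw [QuadraticAlgebra.algebraMap_im, h2]
  obtain ⟨c₀, hc⟩ : ∃ c₀ : K, c = algebraMap K _ c₀ := ⟨c.re, him c hσc⟩
  subst hc
  refine ⟨c₀, ?_, ?_, ?_⟩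
  · intro h0
    apply hc0
    rw [h0, map_zero]
  · intro x y hxy
    apply hcn ⟨x, y⟩
    rw [hnorm]
    exact congrArg _ hxy
  · intro q hq0
    have hσq : starRingEnd (QuadraticAlgebra K d 0) (algebraMap K _ q) = algebraMap K _ q := by
      ext <;> simp [starRingEnd_apply, QuadraticAlgebra.algebraMap_re, QuadraticAlgebra.algebraMap_im]
    have hq0' : algebraMap K (QuadraticAlgebra K d 0) q ≠ 0 := by
      intro h
      exact hq0 (QuadraticAlgebra.algebraMap_injective (by rw [h, map_zero]))
    rcases hdich _ hσq hq0' with ⟨z, hz⟩ | ⟨z, hz⟩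
    · left
      refine ⟨z.re, z.im, (QuadraticAlgebra.algebraMap_injective (a := d) (b := 0)) ?_⟩
      rw [← hnorm, hz]
    · right
      refine ⟨z.re, z.im, (QuadraticAlgebra.algebraMap_injective (a := d) (b := 0)) ?_⟩
      rw [← hnorm, hz, ← map_mul]

/-- **TWO NON-NORMS MULTIPLY TO A NORM** (`[K^× : N_d] ≤ 2`): if `q, q' ≠ 0` are not of the form `x² − d y²` then `q q'` is.
[cite: Neukirch1999, Ch. V (1.3); Ch. V §3 Prop. (3.2) (i) p. 334 (chunk p0302)] [cite: Serre1979, Ch. XIV §2] -/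
theorem binNorm_mul_of_not_binNorm [CharZero K] {d : K} (hd : ∀ e : K, e ^ 2 ≠ d) {q q' : K} (hq0 : q ≠ 0) (hq'0 : q' ≠ 0)
    (hq : ∀ x y : K, x ^ 2 - d * y ^ 2 ≠ q) (hq' : ∀ x y : K, x ^ 2 - d * y ^ 2 ≠ q') :
    ∃ x y : K, x ^ 2 - d * y ^ 2 = q * q' := by
  obtain ⟨t, ht0, -, hdich⟩ := binNorm_dichotomy hd
  have h1 : ∃ x y : K, x ^ 2 - d * y ^ 2 = t * q := (hdich q hq0).resolve_left (fun ⟨x, y, h⟩ => hq x y h)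
  have h2 : ∃ x y : K, x ^ 2 - d * y ^ 2 = t * q' := (hdich q' hq'0).resolve_left (fun ⟨x, y, h⟩ => hq' x y h)
  have h3 : ∃ x y : K, x ^ 2 - d * y ^ 2 = t ^ 2 * (q * q') := by
    obtain ⟨x, y, h⟩ := binNorm_mul h1 h2
    exact ⟨x, y, by linear_combination h⟩
  exact binNorm_of_binNorm_mul (pow_ne_zero 2 ht0) (binNorm_sq d t) h3

/-! ## §3 Distinct quadratic extensions have distinct norm groups; `N_a · N_b = K^×` -/

/-- **EQUAL NORM GROUPS FORCE EQUAL EXTENSIONS** (non-degeneracy of the quadratic Hilbert symbol): if `a, b ∉ K²` and every value of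
`x² − b y²` is a value of `x² − a y²`, then `ab ∈ K²`. [cite: Neukirch1999, Ch. V §3 Prop. (3.2) (vi) p. 334 (chunk p0302)] [cite: Serre1979, Ch. XIV §2–§3] -/
theorem isSquare_mul_of_binNorm_subset [CharZero K] {a b : K} (ha : ∀ e : K, e ^ 2 ≠ a) (hb : ∀ e : K, e ^ 2 ≠ b)
    (hsub : ∀ q : K, q ≠ 0 → (∃ x y : K, x ^ 2 - b * y ^ 2 = q) → ∃ x y : K, x ^ 2 - a * y ^ 2 = q) :
    ∃ e : K, e ^ 2 = a * b := by
  by_contra hab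
  push Not at hab
  have hab' : ∀ e : K, e ^ 2 ≠ a * b := fun e h => hab e h
  have ha0 : a ≠ 0 := fun h => ha 0 (by rw [h]; ring)
  have hb0 : b ≠ 0 := fun h => hb 0 (by rw [h]; ring)
  obtain ⟨ta, hta0, htan, hdicha⟩ := binNorm_dichotomy ha
  obtain ⟨tb, htb0, htbn, hdichb⟩ := binNorm_dichotomy hb
  -- `N_a ⊆ N_b` as well
  have hsub' : ∀ q : K, q ≠ 0 → (∃ x y : K, x ^ 2 - a * y ^ 2 = q) → ∃ x y : K, x ^ 2 - b * y ^ 2 = q := by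
    intro q hq0 hqa
    by_contra hqb
    push Not at hqb
    have hqb' : ∀ x y : K, x ^ 2 - b * y ^ 2 ≠ q := fun x y h => hqb x y h
    -- `t_b q ∈ N_b ⊆ N_a`, so `t_b ∈ N_a`
    have h1 : ∃ x y : K, x ^ 2 - b * y ^ 2 = tb * q := (hdichb q hq0).resolve_left (fun ⟨x, y, h⟩ => hqb' x y h)
    have h2 : ∃ x y : K, x ^ 2 - a * y ^ 2 = tb := by
      have h := hsub _ (mul_ne_zero htb0 hq0) h1
      rw [mul_comm] at h
      exact binNorm_of_binNorm_mul hq0 hqa h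
    -- `t_a ∉ N_b` (else `t_a ∈ N_a`), so `t_b t_a ∈ N_b ⊆ N_a`, so `t_a ∈ N_a`: contradiction
    have h3 : ∀ x y : K, x ^ 2 - b * y ^ 2 ≠ ta := by
      intro x y h
      obtain ⟨x', y', h'⟩ := hsub ta hta0 ⟨x, y, h⟩
      exact htan x' y' h'
    have h4 : ∃ x y : K, x ^ 2 - b * y ^ 2 = tb * ta := (hdichb ta hta0).resolve_left (fun ⟨x, y, h⟩ => h3 x y h)
    have h5 : ∃ x y : K, x ^ 2 - a * y ^ 2 = ta := binNorm_of_binNorm_mul htb0 h2 (hsub _ (mul_ne_zero htb0 hta0) h4)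
    obtain ⟨x, y, h⟩ := h5
    exact htan x y h
  -- every `q ≠ 0` lies in `N_{ab}`
  obtain ⟨t, ht0, htn, -⟩ := binNorm_dichotomy hab'
  have key : ∀ q : K, q ≠ 0 → ∃ x y : K, x ^ 2 - a * b * y ^ 2 = q := by
    intro q hq0
    by_cases hsq : ∃ e : K, e ^ 2 = q
    · obtain ⟨e, rfl⟩ := hsq
      exact binNorm_sq _ e
    push Not at hsq
    have hsq' : ∀ e : K, e ^ 2 ≠ q := fun e h => hsq e h
    -- `ab ∈ N_q`, then symmetry
    refine binNorm_symm hab' ?_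
    by_cases hqa : ∃ x y : K, x ^ 2 - a * y ^ 2 = q
    · exact binNorm_mul (binNorm_symm hsq' hqa) (binNorm_symm hsq' (hsub' q hq0 hqa))
    · push Not at hqa
      have hqa' : ∀ x y : K, x ^ 2 - a * y ^ 2 ≠ q := fun x y h => hqa x y h
      have hqb' : ∀ x y : K, x ^ 2 - b * y ^ 2 ≠ q := by
        intro x y h
        obtain ⟨x', y', h'⟩ := hsub q hq0 ⟨x, y, h⟩
        exact hqa' x' y' h'
      have haq : ∀ x y : K, x ^ 2 - q * y ^ 2 ≠ a := by
        intro x y h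
        obtain ⟨x', y', h'⟩ := binNorm_symm ha ⟨x, y, h⟩
        exact hqa' x' y' h'
      have hbq : ∀ x y : K, x ^ 2 - q * y ^ 2 ≠ b := by
        intro x y h
        obtain ⟨x', y', h'⟩ := binNorm_symm hb ⟨x, y, h⟩
        exact hqb' x' y' h'
      exact binNorm_mul_of_not_binNorm hsq' ha0 hb0 haq hbq
  obtain ⟨x, y, h⟩ := key t ht0
  exact htn x y h

/-- **DISTINCT QUADRATIC EXTENSIONS HAVE DISTINCT NORM GROUPS**: for `a, b, ab ∉ K²` some value of `x² − b y²` (non-zero) is not a value of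
`x² − a y²`. [cite: Neukirch1999, Ch. V §3 Prop. (3.2) (iii), (vi) p. 334 (chunk p0302)] [cite: Serre1979, Ch. XIV §2–§3] -/
theorem exists_binNorm_not_binNorm [CharZero K] {a b : K} (ha : ∀ e : K, e ^ 2 ≠ a) (hb : ∀ e : K, e ^ 2 ≠ b)
    (hab : ∀ e : K, e ^ 2 ≠ a * b) :
    ∃ e : K, e ≠ 0 ∧ (∃ x y : K, x ^ 2 - b * y ^ 2 = e) ∧ ∀ x y : K, x ^ 2 - a * y ^ 2 ≠ e := by
  by_contra h
  push Not at h
  obtain ⟨e, he⟩ := isSquare_mul_of_binNorm_subset ha hb (fun q hq0 hqb => by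
    obtain ⟨x, y, hxy⟩ := h q hq0 hqb
    exact ⟨x, y, hxy⟩)
  exact hab e he

/-- **`N_a · N_b = K^×`** for `a, b, ab ∉ K²`: every `c ≠ 0` is a product `(p² − a q²)(r² − b s²)`.
[cite: Neukirch1999, Ch. V §3 Prop. (3.2) (i), (vi) p. 334 (chunk p0302)] [cite: Serre1979, Ch. XIV §2–§3] -/
theorem exists_eq_binNorm_mul_binNorm [CharZero K] {a b : K} (ha : ∀ e : K, e ^ 2 ≠ a) (hb : ∀ e : K, e ^ 2 ≠ b)
    (hab : ∀ e : K, e ^ 2 ≠ a * b) {c : K} (hc0 : c ≠ 0) :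
    ∃ p q r s : K, c = (p ^ 2 - a * q ^ 2) * (r ^ 2 - b * s ^ 2) := by
  obtain ⟨e, he0, ⟨r, s, hrs⟩, hea⟩ := exists_binNorm_not_binNorm ha hb hab
  by_cases hca : ∃ x y : K, x ^ 2 - a * y ^ 2 = c
  · obtain ⟨p, q, hpq⟩ := hca
    exact ⟨p, q, 1, 0, by rw [hpq]; ring⟩
  · push Not at hca
    have hca' : ∀ x y : K, x ^ 2 - a * y ^ 2 ≠ c := fun x y h => hca x y h
    have hei : ∀ x y : K, x ^ 2 - a * y ^ 2 ≠ e⁻¹ := by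
      intro x y h
      obtain ⟨x', y', h'⟩ := binNorm_inv (inv_ne_zero he0) ⟨x, y, h⟩
      rw [inv_inv] at h'
      exact hea x' y' h'
    obtain ⟨p, q, hpq⟩ := binNorm_mul_of_not_binNorm ha hc0 (inv_ne_zero he0) hca' hei
    refine ⟨p, q, r, s, ?_⟩
    rw [hpq, hrs]
    field_simp

/-- **`N_a · N_{ab} = K^×`** for `a, b, ab ∉ K²` — the reading used for an elliptic torus of type (2): with `L = K(√a, √b) ⊃ L₀ = K(√b)`,
`N_{L/L₀}(p + q√a) = p² − a q²` and `N_{L/L₀}(r + s√a√b) = r² − ab s²`, so `K^× ⊆ N_{L/L₀}(L^×)`: every `c ≠ 0` is `(p² − a q²)(r² − ab s²)`.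
[cite: Neukirch1999, Ch. V §3 Prop. (3.2) p. 334 (chunk p0302)] [cite: Rogawski1990, §3.12 Prop. 3.12.1 (d) p. 37 (chunk p0041)] -/
theorem exists_eq_binNorm_mul_binNorm' [CharZero K] {a b : K} (ha : ∀ e : K, e ^ 2 ≠ a) (hb : ∀ e : K, e ^ 2 ≠ b)
    (hab : ∀ e : K, e ^ 2 ≠ a * b) {c : K} (hc0 : c ≠ 0) :
    ∃ p q r s : K, c = (p ^ 2 - a * q ^ 2) * (r ^ 2 - a * b * s ^ 2) := by
  have ha0 : a ≠ 0 := fun h => ha 0 (by rw [h]; ring)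
  have haab : ∀ e : K, e ^ 2 ≠ a * (a * b) := by
    intro e h
    apply hb (e / a)
    field_simp
    linear_combination h
  exact exists_eq_binNorm_mul_binNorm ha hab haab hc0

end LocalField

end Literature.NumberTheory.LocalFields.QuadraticNormGroups

end
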